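import Summits.CriticalPhenomena.Ising3DConformalLimit.Theorems.HarmonicMomentsIsotropyHarmonicDilutionGaussianRungSymbol
import Summits.CriticalPhenomena.Ising3DConformalLimit.Theorems.HarmonicMomentsIsotropyDilutionTransferDefs
import Literature.Barriers.CriticalPhenomena.GaussianDominationRouteGreen
import HarnessLib

/-!
# Route HarmonicMomentsIsotropy — the Gaussian rung of `HarmonicDilution`, II: random-walk moments

Support file for item `stmt-CriticalPhenomena-6034` (`HarmonicDilution`), continuing
`…GaussianRungSymbol`.  Here the discrete Laplacian `N` on `ℝ[X₀,X₁,X₂]` meets the simple random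
walk on `ℤ³` (step distribution `D = srwStep 3`, convolution powers `D^{⋆n} = convPow D n`, Green
function `C_t = srwGreen 3 t = ∑ₙ tⁿ D^{⋆n}` of the tree):

* `convPow_srwStep_eq_zero` — `D^{⋆n}` is supported in the box `‖x‖_∞ ≤ n`;
* `latticeConv_srwStep` — `(f ⋆ D)(x) = 6⁻¹ ∑_{y ∼ x} f(y)`, and `latticeConv_eval_srwStep` — on
  polynomial weights `W = Q ∘ ι` this is `W_{(1 + N/6) Q}`;
* `tsum_eval_mul_convPow` — **the moment formula** `∑ₓ Q(x) D^{⋆n}(x) = ((1 + N/6)ⁿ Q)(0)`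
  (`= E[Q(Sₙ)]`), by induction on `n` (the transition operator is self-adjoint);
* `eval_zero_pop_iterate` — the binomial expansion `((1 + N/6)ⁿ Q)(0) = ∑_{k ≤ K} C(n,k) 6^{-k}
  (N^k Q)(0)` once `N^{K+1} Q = 0`;
* `tsum_choose_mul_pow` — `∑ₙ C(n,k) tⁿ = t^k/(1-t)^{k+1}`;
* `tsum_eval_mul_srwGreen` — **the Green pairing** `∑ₓ Q(x) C_t(x) = ∑_{k ≤ K} 6^{-k} (N^k Q)(0)
  t^k/(1-t)^{k+1}` for `0 ≤ t < 1`: a finite Laurent polynomial in `1 - t` whose top order is the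
  top lattice moment — zero for harmonic weights, positive for `|x|^{2p}` (file `…Symbol`).

Reference: CampostriniEtAl1998 §4.2 (the massive Gaussian propagator `1/(p̂² + m²) =
(λ/6) ∑ₙ λⁿ D̂ⁿ`, `m² = 6(1-λ)/λ`); Heydenreich–van der Hofstad 2017 (2.2.8)–(2.2.10) for `C_λ`.
-/

noncomputable section

open MvPolynomial Finset Filter
open Literature.Probability.LatticeModels (Site zdGraph zdGraph_adj_iff neighborFinset_zdGraph_eq_image
  single_signedUnit_injective)
open Literature.Barriers.CriticalPhenomena (srwStep srwGreen srwStep_neg srwStep_nonneg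
  convPow_srwStep_nonneg tsum_convPow_srwStep_le_one summable_convPow_srwStep)
open Literature.Barriers.CriticalPhenomena.SpreadOutIsing (delta0 latticeConv convPow delta0_zero
  delta0_of_ne_zero)

namespace Summit.CriticalPhenomena.Ising3DConformalLimit.Theorems.HarmonicMomentsIsotropy.GaussianRung

open Summit.CriticalPhenomena.Ising3DConformalLimit.Theorems.HarmonicMomentsIsotropy (siteW siteW_apply)
open Summit.CriticalPhenomena.Ising3DConformalLimit.Theorems.HarmonicMomentsIsotropy.Fischer (Poly)

/-- The transition operator `1 + N/6` of the simple random walk, acting on polynomial weights. -/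
local notation "pop" => (LinearMap.id + (6 : ℝ)⁻¹ • dlap : Poly →ₗ[ℝ] Poly)

/-! ## Support and neighbour sums of the step distribution -/

/-- The box `‖x‖_∞ ≤ n` of `ℤ³` as a finset. -/
theorem mem_box_iff (n : ℕ) (x : Site 3) :
    x ∈ Fintype.piFinset (fun _ : Fin 3 => Finset.Icc (-(n : ℤ)) n) ↔ ∀ i, -(n : ℤ) ≤ x i ∧ x i ≤ n := by
  simp only [Fintype.mem_piFinset, Finset.mem_Icc]

/-- `D(x - y) ≠ 0` forces `y = x ∓ eᵢ`. -/
theorem exists_single_of_srwStep_ne_zero {x y : Site 3} (h : srwStep 3 (x - y) ≠ 0) :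
    ∃ i : Fin 3, y = x - Pi.single i 1 ∨ y = x + Pi.single i 1 := by
  have hadj : (zdGraph 3).Adj 0 (x - y) := by
    by_contra hn
    exact h (by unfold srwStep; rw [if_neg hn])
  obtain ⟨i, hi | hi⟩ := (zdGraph_adj_iff 0 (x - y)).1 hadj
  · exact ⟨i, Or.inl (by rw [zero_add] at hi; rw [← hi, sub_sub_cancel])⟩
  · refine ⟨i, Or.inr ?_⟩
    have : x - y = -Pi.single i 1 := eq_neg_of_add_eq_zero_left hi.symm
    rw [sub_eq_iff_eq_add] at this
    rw [this]; abel

/-- **Support of `D^{⋆n}`**: the `n`-step distribution lives in the box `‖x‖_∞ ≤ n`. -/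
theorem convPow_srwStep_eq_zero :
    ∀ (n : ℕ) (x : Site 3), x ∉ Fintype.piFinset (fun _ : Fin 3 => Finset.Icc (-(n : ℤ)) n) →
      convPow (srwStep 3) n x = 0
  | 0, x, hx => by
    show delta0 x = 0
    refine delta0_of_ne_zero fun h => hx ?_
    rw [mem_box_iff]
    intro i; rw [h]; simp
  | n + 1, x, hx => by
    show ∑' y : Site 3, convPow (srwStep 3) n y * srwStep 3 (x - y) = 0
    refine (tsum_congr fun y => ?_).trans tsum_zero
    by_cases hs : srwStep 3 (x - y) = 0
    · rw [hs, mul_zero]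
    · rw [convPow_srwStep_eq_zero n y fun hy => hx ?_, zero_mul]
      rw [mem_box_iff] at hy ⊢
      obtain ⟨i, rfl | rfl⟩ := exists_single_of_srwStep_ne_zero hs
      · intro j
        have := hy j
        rw [Pi.sub_apply, Pi.single_apply] at this
        split_ifs at this <;> push_cast <;> omega
      · intro j
        have := hy j
        rw [Pi.add_apply, Pi.single_apply] at this
        split_ifs at this <;> push_cast <;> omega

/-- `D(eᵢ) = 1/6`. -/
theorem srwStep_single (i : Fin 3) : srwStep 3 (Pi.single i 1) = (6 : ℝ)⁻¹ := by
  have hadj : (zdGraph 3).Adj 0 (Pi.single i 1) :=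
    (zdGraph_adj_iff 0 _).2 ⟨i, Or.inl (by rw [zero_add])⟩
  unfold srwStep; rw [if_pos hadj]; norm_num

/-- `D(-eᵢ) = 1/6`. -/
theorem srwStep_neg_single (i : Fin 3) : srwStep 3 (-Pi.single i 1) = (6 : ℝ)⁻¹ := by
  rw [srwStep_neg, srwStep_single]

/-- **Neighbour-sum form of one convolution step**: `(f ⋆ D)(x) = 6⁻¹ ∑ᵢ (f(x+eᵢ) + f(x-eᵢ))`
(no summability needed: the sum is finite). -/
theorem latticeConv_srwStep (f : Site 3 → ℝ) (x : Site 3) :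
    latticeConv f (srwStep 3) x =
      (6 : ℝ)⁻¹ * ∑ i : Fin 3, (f (x + Pi.single i 1) + f (x - Pi.single i 1)) := by
  unfold latticeConv
  set g : Fin 3 × Bool → Site 3 := fun p => x + Pi.single p.1 (if p.2 then 1 else -1) with hg
  have hinj : Function.Injective g := fun p q h => single_signedUnit_injective (add_left_cancel h)
  rw [tsum_eq_sum (s := (univ : Finset (Fin 3 × Bool)).image g) fun y hy => ?_]
  · rw [Finset.sum_image fun p _ q _ h => hinj h, Fintype.sum_prod_type, Finset.mul_sum]
    refine Finset.sum_congr rfl fun i _ => ?_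
    rw [Fintype.sum_bool]
    simp only [hg, if_true, Bool.false_eq_true, if_false]
    rw [Pi.single_neg, ← sub_eq_add_neg, sub_add_cancel_left, sub_sub_cancel, srwStep_neg_single,
      srwStep_single]
    ring
  · have hs : srwStep 3 (x - y) = 0 := by
      by_contra hne
      obtain ⟨i, rfl | rfl⟩ := exists_single_of_srwStep_ne_zero hne
      · exact hy (mem_image.2 ⟨(i, false), mem_univ _, by simp [hg, sub_eq_add_neg, Pi.single_neg]⟩)
      · exact hy (mem_image.2 ⟨(i, true), mem_univ _, by simp [hg]⟩)
    rw [hs, mul_zero]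

/-- Lattice sites embed additively into `ℝ³`: `ι(x ± eᵢ) = ι(x) ± eᵢ`. -/
theorem siteW_add_single (x : Site 3) (i : Fin 3) (c : ℤ) :
    siteW (x + Pi.single i c) = siteW x + Pi.single i (c : ℝ) := by
  funext j
  simp only [siteW_apply, Pi.add_apply, Pi.single_apply, Int.cast_add, Int.cast_ite, Int.cast_zero]

/-- `ι(0) = 0`. -/
theorem siteW_zero : siteW (0 : Site 3) = 0 := by
  funext j; simp only [siteW_apply, Pi.zero_apply, Int.cast_zero]

/-- **One random-walk step on a polynomial weight**: `(Q∘ι ⋆ D)(x) = ((1 + N/6) Q)(ι x)`. -/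
theorem latticeConv_eval_srwStep (Q : Poly) (x : Site 3) :
    latticeConv (fun y => eval (siteW y) Q) (srwStep 3) x = eval (siteW x) (pop Q) := by
  rw [latticeConv_srwStep, LinearMap.add_apply, LinearMap.id_apply, LinearMap.smul_apply, map_add,
    smul_eval, eval_dlap]
  have e : ∀ i : Fin 3, eval (siteW (x + Pi.single i 1)) Q + eval (siteW (x - Pi.single i 1)) Q =
      eval (siteW x + Pi.single i 1) Q + eval (siteW x - Pi.single i 1) Q := by
    intro i
    rw [sub_eq_add_neg x, ← Pi.single_neg, siteW_add_single, siteW_add_single, Int.cast_neg,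
      Int.cast_one, Pi.single_neg, ← sub_eq_add_neg]
  simp only [e]
  ring

/-! ## Moments of `D^{⋆n}` -/

/-- **Moment formula**: `∑ₓ Q(x) D^{⋆n}(x) = ((1 + N/6)ⁿ Q)(0)` — the expectation of a polynomial
of the position of the simple random walk after `n` steps. -/
theorem tsum_eval_mul_convPow :
    ∀ (n : ℕ) (Q : Poly), ∑' x : Site 3, eval (siteW x) Q * convPow (srwStep 3) n x =
      eval 0 (pop^[n] Q)
  | 0, Q => by
    rw [Function.iterate_zero, id_eq, tsum_eq_single (0 : Site 3) fun x hx => ?_]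
    · show eval (siteW 0) Q * delta0 0 = _
      rw [delta0_zero, mul_one, siteW_zero]
    · show eval (siteW x) Q * delta0 x = 0
      rw [delta0_of_ne_zero hx, mul_zero]
  | n + 1, Q => by
    classical
    -- both variables range over finite boxes
    set B : ℕ → Finset (Site 3) := fun m => Fintype.piFinset fun _ : Fin 3 => Finset.Icc (-(m : ℤ)) m
      with hB
    have hsupp : ∀ m y, y ∉ B m → convPow (srwStep 3) m y = 0 := fun m y hy =>
      convPow_srwStep_eq_zero m y hy
    set F : Site 3 → Site 3 → ℝ := fun x y =>
      eval (siteW x) Q * (convPow (srwStep 3) n y * srwStep 3 (x - y)) with hF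
    have hFzero : ∀ x y, (x, y) ∉ B (n + 1) ×ˢ B n → F x y = 0 := by
      intro x y hxy
      rw [Finset.mem_product, not_and_or] at hxy
      rcases hxy with hx | hy
      · by_cases hs : srwStep 3 (x - y) = 0
        · simp only [hF, hs, mul_zero]
        · by_cases hy : y ∈ B n
          · exfalso; apply hx
            rw [hB, mem_box_iff] at hy ⊢
            obtain ⟨i, rfl | rfl⟩ := exists_single_of_srwStep_ne_zero hs
            · intro j; have := hy j
              rw [Pi.sub_apply, Pi.single_apply] at this
              split_ifs at this <;> push_cast <;> omega
            · intro j; have := hy j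
              rw [Pi.add_apply, Pi.single_apply] at this
              split_ifs at this <;> push_cast <;> omega
          · simp only [hF, hsupp n y hy, zero_mul, mul_zero]
      · simp only [hF, hsupp n y hy, zero_mul, mul_zero]
    have hsum : Summable (Function.uncurry F) :=
      summable_of_ne_finset_zero (s := B (n + 1) ×ˢ B n) fun p hp => hFzero p.1 p.2 hp
    calc ∑' x : Site 3, eval (siteW x) Q * convPow (srwStep 3) (n + 1) x
        = ∑' x, ∑' y, F x y := by
          refine tsum_congr fun x => ?_
          show eval (siteW x) Q * ∑' y, convPow (srwStep 3) n y * srwStep 3 (x - y) = _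
          rw [← tsum_mul_left]
      _ = ∑' y, ∑' x, F x y := (hsum.tsum_comm).symm
      _ = ∑' y, convPow (srwStep 3) n y * eval (siteW y) (pop Q) := by
          refine tsum_congr fun y => ?_
          rw [← latticeConv_eval_srwStep, latticeConv, ← tsum_mul_left]
          refine tsum_congr fun x => ?_
          simp only [hF]
          rw [srwStep_neg' x y]
          ring
      _ = ∑' y, eval (siteW y) (pop Q) * convPow (srwStep 3) n y := tsum_congr fun y => mul_comm _ _
      _ = eval 0 (pop^[n] (pop Q)) := tsum_eval_mul_convPow n (pop Q)
      _ = eval 0 (pop^[n + 1] Q) := by rw [Function.iterate_succ_apply]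
  where
    /-- symmetry of the step, in the form used above -/
    srwStep_neg' (x y : Site 3) : srwStep 3 (x - y) = srwStep 3 (y - x) := by
      rw [← srwStep_neg, neg_sub]

/-- Binomial expansion of the transition operator: once `N^{K+1} Q = 0`,
`((1 + N/6)ⁿ Q)(0) = ∑_{k ≤ K} C(n,k) 6^{-k} (N^k Q)(0)` for every `n`. -/
theorem eval_zero_pop_iterate (Q : Poly) {K : ℕ} (hK : dlap^[K + 1] Q = 0) (n : ℕ) :
    eval 0 (pop^[n] Q) =
      ∑ k ∈ range (K + 1), (n.choose k : ℝ) * ((6 : ℝ)⁻¹ ^ k * eval 0 (dlap^[k] Q)) := by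
  -- the operator identity `(1 + cN)ⁿ = ∑ C(n,k) cᵏ Nᵏ` in `End(ℝ[X])`
  have hpow : (pop : Poly →ₗ[ℝ] Poly) ^ n =
      ∑ k ∈ range (n + 1), ((n.choose k : ℝ) * (6 : ℝ)⁻¹ ^ k) • dlap ^ k := by
    have hc : Commute ((6 : ℝ)⁻¹ • dlap : Module.End ℝ Poly) 1 := Commute.one_right _
    rw [show (pop : Module.End ℝ Poly) = (6 : ℝ)⁻¹ • dlap + 1 from add_comm _ _, hc.add_pow]
    refine Finset.sum_congr rfl fun k _ => ?_
    rw [one_pow, mul_one, smul_pow,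
      show ((n.choose k : ℕ) : Module.End ℝ Poly) = ((n.choose k : ℕ) : ℝ) • (1 : Module.End ℝ Poly) by
        rw [← map_natCast (algebraMap ℝ (Module.End ℝ Poly)), Algebra.algebraMap_eq_smul_one],
      smul_mul_smul_comm, mul_one, mul_comm]
  have hvan : ∀ k, K < k → dlap^[k] Q = 0 := by
    intro k hk
    obtain ⟨j, rfl⟩ : ∃ j, k = j + (K + 1) := ⟨k - (K + 1), by omega⟩
    rw [Function.iterate_add_apply, hK]
    exact Function.iterate_fixed (map_zero dlap) j
  have happ : pop^[n] Q = ∑ k ∈ range (n + 1), ((n.choose k : ℝ) * (6 : ℝ)⁻¹ ^ k) • dlap^[k] Q := by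
    rw [← Module.End.pow_apply, hpow, LinearMap.coe_sum, Finset.sum_apply]
    refine Finset.sum_congr rfl fun k _ => ?_
    rw [LinearMap.smul_apply, Module.End.pow_apply]
  rw [happ, map_sum]
  simp only [smul_eval, mul_assoc]
  -- both index ranges can be enlarged to a common one: the extra terms vanish
  have key : ∀ N, ∑ k ∈ range (N + n + K + 2), (n.choose k : ℝ) * ((6 : ℝ)⁻¹ ^ k * eval 0 (dlap^[k] Q))
      = ∑ k ∈ range (n + 1), (n.choose k : ℝ) * ((6 : ℝ)⁻¹ ^ k * eval 0 (dlap^[k] Q)) ∧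
      ∑ k ∈ range (N + n + K + 2), (n.choose k : ℝ) * ((6 : ℝ)⁻¹ ^ k * eval 0 (dlap^[k] Q))
      = ∑ k ∈ range (K + 1), (n.choose k : ℝ) * ((6 : ℝ)⁻¹ ^ k * eval 0 (dlap^[k] Q)) := by
    intro N
    constructor
    · refine (Finset.sum_subset (range_subset_range.2 (by omega)) fun k hk hk' => ?_).symm
      rw [mem_range, not_lt] at hk'
      rw [Nat.choose_eq_zero_of_lt (by omega), Nat.cast_zero, zero_mul]
    · refine (Finset.sum_subset (range_subset_range.2 (by omega)) fun k hk hk' => ?_).symm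
      rw [mem_range, not_lt] at hk'
      rw [hvan k (by omega), map_zero, mul_zero, mul_zero]
  rw [← (key 0).1, (key 0).2]

/-! ## Geometric–binomial sums and the Green pairing -/

/-- `∑ₙ C(n,k) tⁿ = tᵏ/(1-t)^{k+1}` for `0 ≤ t < 1`, with summability. -/
theorem hasSum_choose_mul_pow (k : ℕ) {t : ℝ} (ht0 : 0 ≤ t) (ht1 : t < 1) :
    HasSum (fun n : ℕ => (n.choose k : ℝ) * t ^ n) (t ^ k / (1 - t) ^ (k + 1)) := by
  have ht : ‖t‖ < 1 := by rwa [Real.norm_eq_abs, abs_of_nonneg ht0]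
  have hshift : HasSum (fun n : ℕ => ((n + k).choose k : ℝ) * t ^ (n + k))
      (t ^ k / (1 - t) ^ (k + 1)) := by
    have h := (summable_choose_mul_geometric_of_norm_lt_one k ht).hasSum
    rw [tsum_choose_mul_geometric_of_norm_lt_one k ht] at h
    have h' := h.mul_left (t ^ k)
    rw [mul_one_div] at h'
    have e : (fun i : ℕ => t ^ k * (((i + k).choose k : ℝ) * t ^ i)) =
        fun n : ℕ => ((n + k).choose k : ℝ) * t ^ (n + k) := by
      funext n; ring
    rwa [e] at h'
  rw [← hasSum_nat_add_iff' k]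
  have hz : ∑ i ∈ range k, ((i.choose k : ℕ) : ℝ) * t ^ i = 0 := by
    refine Finset.sum_eq_zero fun i hi => ?_
    rw [Nat.choose_eq_zero_of_lt (mem_range.1 hi), Nat.cast_zero, zero_mul]
  rw [hz, sub_zero]
  exact hshift

/-- A crude polynomial-growth bound: on the box `‖x‖_∞ ≤ n`, `|Q(x)| ≤ A_Q (n+1)^{deg Q}`. -/
theorem abs_eval_siteW_le (Q : Poly) :
    ∃ A : ℝ, 0 ≤ A ∧ ∀ (n : ℕ) (x : Site 3),
      x ∈ Fintype.piFinset (fun _ : Fin 3 => Finset.Icc (-(n : ℤ)) n) →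
        |eval (siteW x) Q| ≤ A * ((n : ℝ) + 1) ^ Q.totalDegree := by
  refine ⟨∑ s ∈ Q.support, |coeff s Q|, Finset.sum_nonneg fun _ _ => abs_nonneg _, fun n x hx => ?_⟩
  rw [mem_box_iff] at hx
  rw [eval_eq', Finset.sum_mul]
  refine (Finset.abs_sum_le_sum_abs _ _).trans (Finset.sum_le_sum fun s hs => ?_)
  rw [abs_mul, Finset.abs_prod]
  refine mul_le_mul_of_nonneg_left ?_ (abs_nonneg _)
  have hxi : ∀ i, |siteW x i| ≤ (n : ℝ) + 1 := by
    intro i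
    rw [siteW_apply, ← Int.cast_abs]
    have := hx i
    have h' : |x i| ≤ (n : ℤ) + 1 := by rw [abs_le]; omega
    exact_mod_cast h'
  calc ∏ i, |siteW x i ^ s i| = ∏ i, |siteW x i| ^ s i := by simp_rw [abs_pow]
    _ ≤ ∏ i : Fin 3, ((n : ℝ) + 1) ^ s i :=
        Finset.prod_le_prod (fun i _ => by positivity) fun i _ =>
          pow_le_pow_left₀ (abs_nonneg _) (hxi i) _
    _ = ((n : ℝ) + 1) ^ (Finsupp.degree s) := by
        rw [Finset.prod_pow_eq_pow_sum, Finsupp.degree_eq_sum]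
    _ ≤ ((n : ℝ) + 1) ^ Q.totalDegree :=
        pow_le_pow_right₀ (by linarith [n.cast_nonneg (α := ℝ)])
          (by rw [Finsupp.degree_apply]; exact le_totalDegree hs)

/-- `∑ₙ tⁿ (n+1)^q < ∞` for `0 ≤ t < 1`. -/
theorem summable_pow_mul_succ_pow (q : ℕ) {t : ℝ} (ht0 : 0 ≤ t) (ht1 : t < 1) :
    Summable fun n : ℕ => t ^ n * ((n : ℝ) + 1) ^ q := by
  have ht : ‖t‖ < 1 := by rwa [Real.norm_eq_abs, abs_of_nonneg ht0]
  -- `(n+1)^q = ∑_j C(q,j) n^j`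
  have e : (fun n : ℕ => t ^ n * ((n : ℝ) + 1) ^ q) =
      fun n : ℕ => ∑ j ∈ range (q + 1), (q.choose j : ℝ) * ((n : ℝ) ^ j * t ^ n) := by
    funext n
    rw [add_pow, Finset.mul_sum]
    refine Finset.sum_congr rfl fun j _ => ?_
    rw [one_pow, mul_one]; ring
  rw [e]
  exact summable_sum fun j _ => (summable_pow_mul_geometric_of_norm_lt_one j ht).mul_left _

/-- **The Green pairing of a polynomial weight.**  For `0 ≤ t < 1` and `N^{K+1} Q = 0`,
`∑ₓ Q(x) C_t(x) = ∑_{k ≤ K} 6^{-k} (N^k Q)(0) · t^k/(1-t)^{k+1}`. -/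
theorem tsum_eval_mul_srwGreen (Q : Poly) {K : ℕ} (hK : dlap^[K + 1] Q = 0) {t : ℝ}
    (ht0 : 0 ≤ t) (ht1 : t < 1) :
    ∑' x : Site 3, eval (siteW x) Q * srwGreen 3 t x =
      ∑ k ∈ range (K + 1), (6 : ℝ)⁻¹ ^ k * eval 0 (dlap^[k] Q) * (t ^ k / (1 - t) ^ (k + 1)) := by
  classical
  obtain ⟨A, hA0, hA⟩ := abs_eval_siteW_le Q
  set q := Q.totalDegree with hq
  -- the double family `(n, x) ↦ Q(x) tⁿ D^{⋆n}(x)` is absolutely summable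
  set F : ℕ → Site 3 → ℝ := fun n x => eval (siteW x) Q * (t ^ n * convPow (srwStep 3) n x) with hF
  have hbound : ∀ n x, ‖F n x‖ ≤ A * ((n : ℝ) + 1) ^ q * (t ^ n * convPow (srwStep 3) n x) := by
    intro n x
    rw [Real.norm_eq_abs, hF, abs_mul, abs_of_nonneg (mul_nonneg (pow_nonneg ht0 n)
      (convPow_srwStep_nonneg n x))]
    by_cases hx : x ∈ Fintype.piFinset (fun _ : Fin 3 => Finset.Icc (-(n : ℤ)) n)
    · exact mul_le_mul_of_nonneg_right (hA n x hx)
        (mul_nonneg (pow_nonneg ht0 n) (convPow_srwStep_nonneg n x))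
    · rw [convPow_srwStep_eq_zero n x hx, mul_zero, mul_zero, mul_zero]
  have hG : Summable (Function.uncurry fun (n : ℕ) (x : Site 3) => A * ((n : ℝ) + 1) ^ q *
      (t ^ n * convPow (srwStep 3) n x)) := by
    refine (summable_prod_of_nonneg fun p => ?_).2 ⟨fun n => ?_, ?_⟩
    · exact mul_nonneg (mul_nonneg hA0 (by positivity))
        (mul_nonneg (pow_nonneg ht0 _) (convPow_srwStep_nonneg _ _))
    · simpa only [Function.uncurry_apply_pair] using
        ((summable_convPow_srwStep n).mul_left (t ^ n)).mul_left (A * ((n : ℝ) + 1) ^ q)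
    · simp only [Function.uncurry_apply_pair]
      refine Summable.of_nonneg_of_le (fun n => ?_) (fun n => ?_)
        ((summable_pow_mul_succ_pow q ht0 ht1).mul_left A)
      · exact tsum_nonneg fun x => mul_nonneg (mul_nonneg hA0 (by positivity))
          (mul_nonneg (pow_nonneg ht0 _) (convPow_srwStep_nonneg _ _))
      · rw [tsum_mul_left, tsum_mul_left]
        calc A * ((n : ℝ) + 1) ^ q * (t ^ n * ∑' x, convPow (srwStep 3) n x)
            ≤ A * ((n : ℝ) + 1) ^ q * (t ^ n * 1) :=
              mul_le_mul_of_nonneg_left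
                (mul_le_mul_of_nonneg_left (tsum_convPow_srwStep_le_one n) (pow_nonneg ht0 n))
                (mul_nonneg hA0 (by positivity))
          _ = A * (t ^ n * ((n : ℝ) + 1) ^ q) := by ring
  have hsum : Summable (Function.uncurry F) :=
    Summable.of_norm_bounded hG fun p => hbound p.1 p.2
  calc ∑' x : Site 3, eval (siteW x) Q * srwGreen 3 t x
      = ∑' x, ∑' n, F n x := by
        refine tsum_congr fun x => ?_
        rw [srwGreen, ← tsum_mul_left]
    _ = ∑' n, ∑' x, F n x := hsum.tsum_comm
    _ = ∑' n, t ^ n * ∑ k ∈ range (K + 1), (n.choose k : ℝ) * ((6 : ℝ)⁻¹ ^ k * eval 0 (dlap^[k] Q)) := by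
        refine tsum_congr fun n => ?_
        rw [← eval_zero_pop_iterate Q hK n, ← tsum_eval_mul_convPow n Q, ← tsum_mul_left]
        exact tsum_congr fun x => by rw [hF]; ring
    _ = ∑' n, ∑ k ∈ range (K + 1),
          ((6 : ℝ)⁻¹ ^ k * eval 0 (dlap^[k] Q)) * ((n.choose k : ℝ) * t ^ n) := by
        refine tsum_congr fun n => ?_
        rw [Finset.mul_sum]
        exact Finset.sum_congr rfl fun k _ => by ring
    _ = ∑ k ∈ range (K + 1), ∑' n : ℕ,
          ((6 : ℝ)⁻¹ ^ k * eval 0 (dlap^[k] Q)) * ((n.choose k : ℝ) * t ^ n) :=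
        Summable.tsum_finsetSum fun k _ => (hasSum_choose_mul_pow k ht0 ht1).summable.mul_left _
    _ = ∑ k ∈ range (K + 1), (6 : ℝ)⁻¹ ^ k * eval 0 (dlap^[k] Q) * (t ^ k / (1 - t) ^ (k + 1)) := by
        refine Finset.sum_congr rfl fun k _ => ?_
        rw [tsum_mul_left, (hasSum_choose_mul_pow k ht0 ht1).tsum_eq]

end Summit.CriticalPhenomena.Ising3DConformalLimit.Theorems.HarmonicMomentsIsotropy.GaussianRung
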